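import Literature.NumberTheory.Automorphic.Liu2021.LemD1AsPrintedIndexed
import Literature.NumberTheory.Automorphic.Liu2021.LemD1AsPrintedTwist
import Literature.NumberTheory.Automorphic.Liu2021.LemD1LocalInjectivity
import Literature.RepresentationTheory.TwistedCoinvariantsCentralCharacterQuotient
import HarnessLib

/-!
# [Liu2021, App. D Lemma D.1 (1) and (3)] as printed: the records see the ⟨CARRIER⟩ only up to equivariant isomorphism
# (transport of `LemD1_1AsPrinted`, `LemD1IndexedFamily.Item1AsPrinted`, `LemD1_3AsPrintedI` along carrier equivalences)

Reproduction ∕ bookkeeping (Literature, THEOREMS ONLY: no definition, no record, no named fact, no `sorry`; nothing of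
[Liu2021] is asserted).

The statement-exact records of `Liu2021/LemD1AsPrinted.lean` (§1: `LemD1Data`, `LemD1_1AsPrinted` — Lemma D.1, first
sentence + (1), `FJcycle.tex` l. 5227–5229) and `Liu2021/LemD1AsPrintedIndexed.lean` (`LemD1IndexedFamily.Item1AsPrinted`,
`LemD1_3AsPrintedI` — Lemma D.1 (3), l. 5233, read on an indexed collection) posit ONE datum per member whose only
non-concrete field is the ⟨CARRIER⟩ `omega = ω(μ, ε) := ω(ε) ∘ ι_μ`, a representation of `U(V)(F) = S.U` on a `ℂ`-space
`V` (object-match duty (b)/(om1) of the tree's record N-f1).  A consumer may present the SAME representation on another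
space — the tree does so constantly: `CentralCharacterQuotient.quotRep` vs `TwistedCoinv.rep`
(`TwistedCoinvariantsCentralCharacterQuotient.lean`), Schwartz–Bruhat models moved along `uEquiv` ∕ `localLineInl`
(`Def411WeilCarriersLocalDataAtV.lean`), the local type `X_v` vs the restricted global carrier
(`Def411WeilCarriersLocalTypesOfEquiv.lean`).  This file records, once and for all, that the CONTENT of the two printed
records is insensitive to such a change of presentation: along `S.U`-equivariant `ℂ`-linear equivalences of the carriers
(`e_i (ω_i(g) x) = ω'_i(g) (e_i x)`; all other fields — the local field, `S`, `μ_i`, `ε_i`, `χ_i` — untouched)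

* §1 (generic, any commutative ring `k`, any groups `G`, `Z`; private plumbing) `augmentation_map_of_equivariant` — the
  `χ`-augmentation submodules correspond under `e` (`(augmentation ρ ζ χ).map e = augmentation ρ' ζ χ`), hence
  `exists_quotRep_equivariant` — an equivariant linear equivalence of the maximal `χ`-quotients
  `V ⧸ augmentation ρ ζ χ ≃ V' ⧸ augmentation ρ' ζ χ` (Mathlib `Submodule.Quotient.equiv`);
* §2 **`LemD1_1AsPrinted.iff_of_carrierEquiv`** — for a datum `L` and a second presentation `ω'` of its carrier on `V'`
  (`e : V ≃ₗ[ℂ] V'` equivariant), `LemD1_1AsPrinted L ↔ LemD1_1AsPrinted {L with omega := ω'}`: «irreducible» (READING I1,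
  tree `isIrreducibleOrZero_iff_of_twist_equivariant` at the trivial twist), «admissible» (READING I2′, tree
  `Representation.isAdmissible_iff_of_equivariant`), «is zero» (READING L5, `Equiv.subsingleton_congr`) all pass along the
  quotient equivalence of §1, and the right-hand side of (1) («`E` is a field», «`V` anisotropic», «`n = 2`», «`χ̌ = μ²`»)
  does not mention the carrier;
* §3 **`LemD1IndexedFamily.Item1AsPrinted.iff_of_carrierEquiv`**, **`LemD1_3AsPrintedI.iff_of_carrierEquiv`**,
  `item1AsPrinted_and_lemD1_3AsPrintedI_iff_of_carrierEquiv` — the same for the indexed records (member by member for (1);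
  for (3) the isomorphism class of each `ω(μ_i, ε_i, χ_i)` is unchanged — `AreIsomorphicRep` is an equivalence relation,
  tree `LemD1LocalInjectivity` — and the printed right-hand side `(μ_j, ε_j, χ_j) = (μ_i, ε_i, χ_i)` does not mention the
  carriers);
* §4 `LemD1Family.item1AsPrinted_iff_of_carrierEquiv`, `LemD1Family.lemD1_3AsPrinted_iff_of_carrierEquiv` — the
  all-triples family forms of `LemD1AsPrinted.lean` §2, through `LemD1Family.toIndexed`.

So a certificate or a hypothesis stated for one presentation of the carriers holds verbatim for every equivariantly
isomorphic presentation (e.g. the character-line certificates of `LemD1AsPrintedIndexedNonVacuity*.lean` for any carriers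
isomorphic to those lines; the displayed rows' `quotRep`-currency and the chain's `TwistedCoinv`-currency).  Nothing here is
a hypothesis or a discharge of any displayed row; HC_CM is NOT proved.

Cell pub-hodgecm2 (COR-CM), audit class of the END rows `hD1''` ∕ `hD3`; seat prover-pub-hodgecm2-b10.

References: [Liu2021] Y. Liu, *Fourier–Jacobi cycles and arithmetic relative trace formula*, Camb. J. Math. 9 (2021) =
arXiv:2102.11518, App. D §D.1 Steps 1–3 (l. 5213–5224), Lemma D.1 (1) (l. 5229), (3) (l. 5233);
[BernsteinZelevinsky1976] I. N. Bernstein, A. V. Zelevinsky, Russian Math. Surveys 31 (1976), §2.1 (smooth ∕ admissible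
representations are defined up to isomorphism); [Bump1997] D. Bump, *Automorphic forms and representations*, CUP 1997, §4.2.
-/

noncomputable section

open Literature.RepresentationTheory
open Literature.RepresentationTheory.Liu2021 (OscillatorStandingData)
open Literature.RepresentationTheory.CentralCharacterQuotient (augmentation quotRep quotRep_mk)

namespace Literature.NumberTheory.Automorphic.Liu2021

/-! ## §1 The maximal `χ`-quotient along an equivariant linear equivalence (generic) -/

namespace LemD1CarrierTransport

section Generic

variable {k G Z V V' : Type*} [CommRing k] [Group G] [Group Z] [AddCommGroup V] [Module k V]
  [AddCommGroup V'] [Module k V']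

/-- **the `χ`-augmentation submodules correspond under an equivariant linear equivalence**: for `e (ρ g v) = ρ' g (e v)`,
`e` maps `Σ_z range (ρ(ζ z) − χ(z)•id)` onto `Σ_z range (ρ'(ζ z) − χ(z)•id)` (each generator `ρ(ζ z) v − χ(z) v` goes to
`ρ'(ζ z) (e v) − χ(z) (e v)`, and `e` is onto). [folklore] -/
private theorem augmentation_map_of_equivariant (ρ : Representation k G V) (ρ' : Representation k G V') (ζ : Z →* G)
    (χ : Z →* kˣ) (e : V ≃ₗ[k] V') (he : ∀ g v, e (ρ g v) = ρ' g (e v)) :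
    (augmentation ρ ζ χ).map (e : V →ₗ[k] V') = augmentation ρ' ζ χ := by
  change (⨆ z : Z, LinearMap.range (ρ (ζ z) - (χ z : k) • LinearMap.id)).map (e : V →ₗ[k] V') =
    ⨆ z : Z, LinearMap.range (ρ' (ζ z) - (χ z : k) • LinearMap.id)
  rw [Submodule.map_iSup]
  refine iSup_congr fun z => ?_
  have hcomp : (e : V →ₗ[k] V').comp (ρ (ζ z) - (χ z : k) • LinearMap.id) =
      (ρ' (ζ z) - (χ z : k) • LinearMap.id).comp (e : V →ₗ[k] V') := by
    ext v
    simp only [LinearMap.coe_comp, Function.comp_apply, LinearMap.sub_apply, LinearMap.smul_apply, LinearMap.id_coe,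
      id_eq, LinearEquiv.coe_coe, map_sub, map_smul, he]
  rw [← LinearMap.range_comp, hcomp, LinearMap.range_comp_of_range_eq_top _ e.range]

/-- **the maximal `χ`-quotients are equivariantly isomorphic along an equivariant linear equivalence of the carriers**
(`V ⧸ augmentation ρ ζ χ ≃ₗ V' ⧸ augmentation ρ' ζ χ`, `mk v ↦ mk (e v)`, intertwining `quotRep ρ` and `quotRep ρ'`).
[folklore] -/
private theorem exists_quotRep_equivariant (ρ : Representation k G V) (ρ' : Representation k G V') {ζ : Z →* G}
    (hζ : ∀ z, ζ z ∈ Subgroup.center G) (χ : Z →* kˣ) (e : V ≃ₗ[k] V') (he : ∀ g v, e (ρ g v) = ρ' g (e v)) :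
    ∃ ē : (V ⧸ augmentation ρ ζ χ) ≃ₗ[k] (V' ⧸ augmentation ρ' ζ χ),
      (∀ v : V, ē (Submodule.Quotient.mk v) = Submodule.Quotient.mk (e v)) ∧
      ∀ (g : G) (x : V ⧸ augmentation ρ ζ χ), ē (quotRep ρ hζ χ g x) = quotRep ρ' hζ χ g (ē x) := by
  refine ⟨Submodule.Quotient.equiv _ _ e (augmentation_map_of_equivariant ρ ρ' ζ χ e he), fun v => ?_, fun g x => ?_⟩
  · rw [Submodule.Quotient.equiv_apply, Submodule.mapQ_apply, LinearEquiv.coe_coe]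
  · obtain ⟨v, rfl⟩ := Submodule.Quotient.mk_surjective _ x
    rw [quotRep_mk, Submodule.Quotient.equiv_apply, Submodule.Quotient.equiv_apply, Submodule.mapQ_apply,
      Submodule.mapQ_apply, LinearEquiv.coe_coe, quotRep_mk, he]

end Generic

end LemD1CarrierTransport

/-! ## §2 Lemma D.1, first sentence + (1), AS PRINTED: invariance under a change of presentation of `ω(μ, ε)` -/

section Single

variable {F E : Type} [Field F] [ValuativeRel F] [TopologicalSpace F] [CommRing E] [Algebra F E]
  [TopologicalSpace E] {n : ℕ} {V V' : Type} [AddCommGroup V] [Module ℂ V] [AddCommGroup V'] [Module ℂ V']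

/-- **[Liu2021, App. D, Lem. D.1, first sentence + (1)] AS PRINTED sees `ω(μ, ε)` only up to equivariant isomorphism.**
For a datum `L` (carrier `L.omega` on `V`) and a second presentation `ω'` of the same representation of `U(V)(F) = S.U` on
`V'` — an `S.U`-equivariant `ℂ`-linear equivalence `e : V ≃ V'`, `e (ω(g) v) = ω'(g) (e v)` —, the record holds for `L` iff it
holds for the datum with `omega := ω'` and every other field (the local field, `S`, `ε`, `μ`, `χ`) unchanged: the maximal
`χ`-quotients `ω(μ, ε, χ)` are equivariantly isomorphic (§1), «irreducible (or zero)», «admissible», «is zero» are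
isomorphism-invariant (READINGS I1, I2′, L5), and the printed right-hand side of (1) does not mention the carrier.
[cite: Liu2021, App. D Lemma D.1 (1)] -/
theorem LemD1_1AsPrinted.iff_of_carrierEquiv (L : LemD1Data F E n V) (ω' : Representation ℂ L.S.U V')
    (e : V ≃ₗ[ℂ] V') (he : ∀ g v, e (L.omega g v) = ω' g (e v)) :
    LemD1_1AsPrinted L ↔ LemD1_1AsPrinted ({ L with omega := ω' } : LemD1Data F E n V') := by
  obtain ⟨ē, -, hē⟩ :=
    LemD1CarrierTransport.exists_quotRep_equivariant L.omega ω' L.S.scalar_mem_center L.chi e he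
  have h1 : IsIrreducibleOrZero (quotRep L.omega L.S.scalar_mem_center L.chi) ↔
      IsIrreducibleOrZero (quotRep ω' L.S.scalar_mem_center L.chi) :=
    isIrreducibleOrZero_iff_of_twist_equivariant _ _ ē 1 fun g x => by
      rw [MonoidHom.one_apply, Units.val_one, one_smul]; exact hē g x
  have h2 : (quotRep L.omega L.S.scalar_mem_center L.chi).IsAdmissible ↔
      (quotRep ω' L.S.scalar_mem_center L.chi).IsAdmissible :=
    Representation.isAdmissible_iff_of_equivariant _ _ ē hē
  have h3 : Subsingleton (V ⧸ augmentation L.omega L.S.scalar L.chi) ↔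
      Subsingleton (V' ⧸ augmentation ω' L.S.scalar L.chi) :=
    Equiv.subsingleton_congr ē.toEquiv
  exact ⟨fun h => ⟨⟨h1.1 h.1.1, h2.1 h.1.2⟩, h3.symm.trans h.2⟩, fun h => ⟨⟨h1.2 h.1.1, h2.2 h.1.2⟩, h3.trans h.2⟩⟩

/-- one direction, for use as a term: the record passes from `L` to the re-presented datum. [cite: Liu2021, App. D Lemma D.1 (1)] -/
theorem LemD1_1AsPrinted.of_carrierEquiv {L : LemD1Data F E n V} (h : LemD1_1AsPrinted L)
    (ω' : Representation ℂ L.S.U V') (e : V ≃ₗ[ℂ] V') (he : ∀ g v, e (L.omega g v) = ω' g (e v)) :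
    LemD1_1AsPrinted ({ L with omega := ω' } : LemD1Data F E n V') :=
  (LemD1_1AsPrinted.iff_of_carrierEquiv L ω' e he).1 h

end Single

/-! ## §3 The indexed records: (1) member by member and (3), along a family of carrier equivalences -/

section Indexed

variable {F E : Type} [Field F] [ValuativeRel F] [TopologicalSpace F] [CommRing E] [Algebra F E]
  [TopologicalSpace E] [IsTopologicalRing E] {n : ℕ} {ι : Type} (Lf : LemD1IndexedFamily F E n ι)
  {V' : ι → Type} [∀ i, AddCommGroup (V' i)] [∀ i, Module ℂ (V' i)]
  (ω' : ∀ i, Representation ℂ Lf.S.U (V' i)) (e : ∀ i, Lf.V i ≃ₗ[ℂ] V' i)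
  (he : ∀ (i : ι) (g : Lf.S.U) (x : Lf.V i), e i (Lf.omega i g x) = ω' i g (e i x))

include e he

/-- the maximal `χ_i`-quotient of member `i` is equivariantly isomorphic to that of the re-presented member (READING L7,
`AreIsomorphicRep`). [cite: Liu2021, App. D Lemma D.1 (3) (l. 5233)] -/
theorem LemD1IndexedFamily.areIsomorphicRep_quot_of_carrierEquiv (i : ι) :
    AreIsomorphicRep (Lf.quot i)
      ((⟨Lf.isNonarchimedeanLocalField, Lf.isModuleTopology, Lf.S, Lf.mu, Lf.eps, Lf.chi, V', ω'⟩ :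
        LemD1IndexedFamily F E n ι).quot i) := by
  obtain ⟨ē, -, hē⟩ := LemD1CarrierTransport.exists_quotRep_equivariant (Lf.omega i) (ω' i) Lf.S.scalar_mem_center
    (Lf.chi i).1 (e i) (he i)
  exact ⟨ē, hē⟩

/-- **[Liu2021, Lem. D.1, first sentence + (1)] for every member, AS PRINTED, is invariant under a change of presentation
of the carriers** `ω(μ_i, ε_i) ↦ ω'_i` along equivariant linear equivalences `e_i` (member by member §2).
[cite: Liu2021, App. D Lemma D.1 (1) (l. 5226–5229)] -/
theorem LemD1IndexedFamily.Item1AsPrinted.iff_of_carrierEquiv :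
    Lf.Item1AsPrinted ↔
      (⟨Lf.isNonarchimedeanLocalField, Lf.isModuleTopology, Lf.S, Lf.mu, Lf.eps, Lf.chi, V', ω'⟩ :
        LemD1IndexedFamily F E n ι).Item1AsPrinted :=
  forall_congr' fun i => LemD1_1AsPrinted.iff_of_carrierEquiv (Lf.single i) (ω' i) (e i) (he i)

/-- **[Liu2021, Lem. D.1 (3)] AS PRINTED, read on an indexed collection, is invariant under a change of presentation of
the carriers**: the isomorphism class of every `ω(μ_i, ε_i, χ_i)` is unchanged (`AreIsomorphicRep` is an equivalence
relation), and the printed right-hand side «`(μ_j, ε_j, χ_j) = (μ_i, ε_i, χ_i)`» does not mention the carriers.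
[cite: Liu2021, App. D Lemma D.1 (3) (l. 5233)] -/
theorem LemD1_3AsPrintedI.iff_of_carrierEquiv :
    LemD1_3AsPrintedI Lf ↔
      LemD1_3AsPrintedI (⟨Lf.isNonarchimedeanLocalField, Lf.isModuleTopology, Lf.S, Lf.mu, Lf.eps, Lf.chi, V', ω'⟩ :
        LemD1IndexedFamily F E n ι) := by
  refine forall_congr' fun _ => forall_congr' fun i => forall_congr' fun j => iff_congr ?_ Iff.rfl
  have hi := Lf.areIsomorphicRep_quot_of_carrierEquiv ω' e he i
  have hj := Lf.areIsomorphicRep_quot_of_carrierEquiv ω' e he j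
  exact ⟨fun h => (hj.symm.trans h).trans hi, fun h => (hj.trans h).trans hi.symm⟩

/-- the pair «(1) for every member ∧ (3)» (the shape displayed by the tree's consumers) is invariant under a change of
presentation of the carriers. [cite: Liu2021, App. D Lemma D.1 (1) and (3)] -/
theorem LemD1IndexedFamily.item1AsPrinted_and_lemD1_3AsPrintedI_iff_of_carrierEquiv :
    (Lf.Item1AsPrinted ∧ LemD1_3AsPrintedI Lf) ↔
      ((⟨Lf.isNonarchimedeanLocalField, Lf.isModuleTopology, Lf.S, Lf.mu, Lf.eps, Lf.chi, V', ω'⟩ :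
          LemD1IndexedFamily F E n ι).Item1AsPrinted ∧
        LemD1_3AsPrintedI (⟨Lf.isNonarchimedeanLocalField, Lf.isModuleTopology, Lf.S, Lf.mu, Lf.eps, Lf.chi, V', ω'⟩ :
          LemD1IndexedFamily F E n ι)) :=
  and_congr (LemD1IndexedFamily.Item1AsPrinted.iff_of_carrierEquiv Lf ω' e he)
    (LemD1_3AsPrintedI.iff_of_carrierEquiv Lf ω' e he)

end Indexed

/-! ## §4 The all-triples family forms of `LemD1AsPrinted.lean` §2 -/

section Family

variable {F E : Type} [Field F] [ValuativeRel F] [TopologicalSpace F] [CommRing E] [Algebra F E]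
  [TopologicalSpace E] [IsTopologicalRing E] {n : ℕ} (Lf : LemD1Family F E n)
  {V' : LemD1.MuSet Lf.S → LemD1.EpsRep Lf.S → Type} [∀ μ e, AddCommGroup (V' μ e)] [∀ μ e, Module ℂ (V' μ e)]
  (ω' : ∀ μ e, Representation ℂ Lf.S.U (V' μ e)) (φ : ∀ μ e, Lf.V μ e ≃ₗ[ℂ] V' μ e)
  (hφ : ∀ μ e (g : Lf.S.U) (x : Lf.V μ e), φ μ e (Lf.omega μ e g x) = ω' μ e g (φ μ e x))

include φ hφ

/-- **[Liu2021, Lem. D.1, first sentence + (1)] at every triple of the all-triples family** is invariant under a change of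
presentation of the carrier family `ω(μ, ε) ↦ ω'(μ, ε)`. [cite: Liu2021, App. D Lemma D.1 (1) (l. 5226–5229)] -/
theorem LemD1Family.item1AsPrinted_iff_of_carrierEquiv :
    Lf.Item1AsPrinted ↔
      (⟨Lf.isNonarchimedeanLocalField, Lf.isModuleTopology, Lf.S, V', ω'⟩ : LemD1Family F E n).Item1AsPrinted :=
  forall_congr' fun μ => forall_congr' fun e => forall_congr' fun χ =>
    LemD1_1AsPrinted.iff_of_carrierEquiv (Lf.single μ e χ) (ω' μ e) (φ μ e) (hφ μ e)

/-- **[Liu2021, Lem. D.1 (3)] for the all-triples family** is invariant under a change of presentation of the carrier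
family (through the indexed form at `LemD1Family.toIndexed`, `lemD1_3AsPrinted_iff_toIndexed`). [cite: Liu2021, App. D Lemma D.1 (3) (l. 5233)] -/
theorem LemD1Family.lemD1_3AsPrinted_iff_of_carrierEquiv :
    LemD1_3AsPrinted Lf ↔
      LemD1_3AsPrinted (⟨Lf.isNonarchimedeanLocalField, Lf.isModuleTopology, Lf.S, V', ω'⟩ : LemD1Family F E n) := by
  rw [LemD1Family.lemD1_3AsPrinted_iff_toIndexed, LemD1Family.lemD1_3AsPrinted_iff_toIndexed]
  exact LemD1_3AsPrintedI.iff_of_carrierEquiv Lf.toIndexed (fun t => ω' t.1 t.2.1) (fun t => φ t.1 t.2.1)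
    fun t => hφ t.1 t.2.1

end Family

end Literature.NumberTheory.Automorphic.Liu2021

end
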